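import Summits.SmoothPoincare4.SmoothPoincare4.Theorems.SymplecticOrigamiFoldedSphereFoldExistencePfaffian

/-!
# The flat fold model `(u₀, u₁, u₂, u₃) ↦ (u₀², u₁, u₂, u₃)` and `ω₀`

Helper file for item `FoldedSphereFoldExistence` (route SymplecticOrigami): linear algebra and
calculus on the model space `ℝ⁴` used by the fold-map pull-back lemma
("the pull-back of `ω₀` by a map folding along `Z` is a folded symplectic form with fold `Z`",
Cannas da Silva 2010, §1; Gromov 1986, §2.1.3):

* `pfaffian_stdSymplecticAlt` — `Pf(ω₀) = 1`;
* `exists_degenerate_comp_iff_not_injective` — `ω₀ ∘ (A × A)` is degenerate iff `A` is not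
  injective;
* the fold model written additively, `u ↦ u + (u₀² - u₀) e₀` (`= (u₀², u₁, u₂, u₃)`): its
  derivative `T(u) = id + (2u₀ - 1) e₀ ⊗ e₀*` (`hasFDerivAt_foldModel`), `det T(u) = 2u₀`
  (`det_foldModelDeriv`), and `T(u) e₀ = 0` on the fold `u₀ = 0`.
-/

noncomputable section

-- the prescribed namespace `Summit.<P>.<Sub>.…` duplicates `SmoothPoincare4` (P = Sub)
set_option linter.dupNamespace false

open scoped Manifold ContDiff Topology
open Set Function
open Literature.Geometry.Symplectic

namespace Summit.SmoothPoincare4.SmoothPoincare4.Theorems.FoldedSphereFoldExistence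

/-! ### `ω₀`: Pfaffian and degeneracy of linear pull-backs -/

/-- `Pf(ω₀) = ω₀(e₀,e₁)ω₀(e₂,e₃) - ω₀(e₀,e₂)ω₀(e₁,e₃) + ω₀(e₀,e₃)ω₀(e₁,e₂) = 1`. [folklore] -/
theorem pfaffian_stdSymplecticAlt : pfaffian stdSymplecticAlt = 1 := by
  simp [pfaffian, stdSymplecticAlt_apply, stdSymplecticForm, stdVec]

/-- **`ω₀ ∘ (A × A)` is degenerate iff `A` is singular**: for a linear endomorphism `A` of `ℝ⁴`,
some non-zero `v` pairs to zero with everything under `(v, w) ↦ ω₀(Av, Aw)` iff `A` is not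
injective (if `A` is injective it is onto, and `ω₀(Av, ·) ≠ 0` by nondegeneracy of `ω₀`).
[folklore] -/
theorem exists_degenerate_comp_iff_not_injective
    (A : EuclideanSpace ℝ (Fin 4) →L[ℝ] EuclideanSpace ℝ (Fin 4)) :
    (∃ v : EuclideanSpace ℝ (Fin 4), v ≠ 0 ∧
        ∀ w : EuclideanSpace ℝ (Fin 4), stdSymplecticAlt ![A v, A w] = 0) ↔
      ¬ Injective A := by
  constructor
  · rintro ⟨v, hv, hker⟩ hinj
    have hAv : A v ≠ 0 := fun h0 => hv (hinj (h0.trans (map_zero A).symm))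
    obtain ⟨w', hw'⟩ := stdSymplecticMForm_nondegenerate 0 (A v) hAv
    have hsurj : Surjective A :=
      (LinearMap.injective_iff_surjective (f := (A : EuclideanSpace ℝ (Fin 4) →ₗ[ℝ]
        EuclideanSpace ℝ (Fin 4)))).1 hinj
    obtain ⟨w, rfl⟩ := hsurj w'
    exact hw' (by rw [stdSymplecticMForm_apply, ← stdSymplecticAlt_apply]; exact hker w)
  · intro hA
    have hker : LinearMap.ker (A : EuclideanSpace ℝ (Fin 4) →ₗ[ℝ] EuclideanSpace ℝ (Fin 4)) ≠ ⊥ := by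
      intro hbot
      exact hA (LinearMap.ker_eq_bot.1 hbot)
    obtain ⟨v, hvker, hv⟩ := Submodule.exists_mem_ne_zero_of_ne_bot hker
    refine ⟨v, hv, fun w => ?_⟩
    have hAv : A v = 0 := hvker
    rw [hAv, stdSymplecticAlt_apply]
    simp [stdSymplecticForm]

/-! ### The fold model and its derivative -/

/-- **Derivative of the fold model** `u ↦ u + (u₀² - u₀) e₀` (`= (u₀², u₁, u₂, u₃)`):
`T(u) = id + (2u₀ - 1) e₀ ⊗ e₀*`. [folklore] -/
theorem hasFDerivAt_foldModel (u : EuclideanSpace ℝ (Fin 4)) :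
    HasFDerivAt (fun u : EuclideanSpace ℝ (Fin 4) =>
        u + ((u 0) ^ 2 - u 0) • EuclideanSpace.single (0 : Fin 4) (1 : ℝ))
      (ContinuousLinearMap.id ℝ (EuclideanSpace ℝ (Fin 4)) +
        ((2 * u 0 - 1) • (EuclideanSpace.proj (0 : Fin 4) : EuclideanSpace ℝ (Fin 4) →L[ℝ] ℝ)).smulRight
          (EuclideanSpace.single (0 : Fin 4) (1 : ℝ))) u := by
  have h0 : HasFDerivAt (fun u : EuclideanSpace ℝ (Fin 4) => u 0)
      (EuclideanSpace.proj (0 : Fin 4) : EuclideanSpace ℝ (Fin 4) →L[ℝ] ℝ) u :=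
    (EuclideanSpace.proj (0 : Fin 4) : EuclideanSpace ℝ (Fin 4) →L[ℝ] ℝ).hasFDerivAt
  have h1 : HasFDerivAt (fun u : EuclideanSpace ℝ (Fin 4) => (u 0) ^ 2 - u 0)
      ((2 * u 0 - 1) • (EuclideanSpace.proj (0 : Fin 4) : EuclideanSpace ℝ (Fin 4) →L[ℝ] ℝ)) u := by
    refine ((h0.pow 2).sub h0).congr_fderiv ?_
    ext v
    simp
    ring
  exact (hasFDerivAt_id u).add (h1.smul_const _)

/-- The fold-model derivative on a vector: `T(u) v = v + (2u₀ - 1) v₀ e₀`. [folklore] -/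
theorem foldModelDeriv_apply (u v : EuclideanSpace ℝ (Fin 4)) :
    (ContinuousLinearMap.id ℝ (EuclideanSpace ℝ (Fin 4)) +
        ((2 * u 0 - 1) • (EuclideanSpace.proj (0 : Fin 4) : EuclideanSpace ℝ (Fin 4) →L[ℝ] ℝ)).smulRight
          (EuclideanSpace.single (0 : Fin 4) (1 : ℝ))) v =
      v + ((2 * u 0 - 1) * v 0) • EuclideanSpace.single (0 : Fin 4) (1 : ℝ) := by
  simp [ContinuousLinearMap.smulRight_apply]

/-- On the fold `u₀ = 0` the fold-model derivative kills `e₀`: `T(u) e₀ = e₀ - e₀ = 0`.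
[folklore] -/
theorem foldModelDeriv_single_eq_zero {u : EuclideanSpace ℝ (Fin 4)} (hu : u 0 = 0) :
    (ContinuousLinearMap.id ℝ (EuclideanSpace ℝ (Fin 4)) +
        ((2 * u 0 - 1) • (EuclideanSpace.proj (0 : Fin 4) : EuclideanSpace ℝ (Fin 4) →L[ℝ] ℝ)).smulRight
          (EuclideanSpace.single (0 : Fin 4) (1 : ℝ))) (EuclideanSpace.single (0 : Fin 4) (1 : ℝ)) = 0 := by
  rw [foldModelDeriv_apply, hu]
  ext i
  fin_cases i <;> simp

/-- **`det T(u) = 2u₀`**: on the standard basis `T(u) e₀ = 2u₀ e₀` and `T(u) eⱼ = eⱼ` for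
`j ≠ 0`, so the determinant is the product `2u₀ · 1 · 1 · 1` (`Basis.det_comp`,
`MultilinearMap.map_smul_univ`). [folklore] -/
theorem det_foldModelDeriv (u : EuclideanSpace ℝ (Fin 4)) :
    LinearMap.det ((ContinuousLinearMap.id ℝ (EuclideanSpace ℝ (Fin 4)) +
        ((2 * u 0 - 1) • (EuclideanSpace.proj (0 : Fin 4) : EuclideanSpace ℝ (Fin 4) →L[ℝ] ℝ)).smulRight
          (EuclideanSpace.single (0 : Fin 4) (1 : ℝ)) :
        EuclideanSpace ℝ (Fin 4) →L[ℝ] EuclideanSpace ℝ (Fin 4)) :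
          EuclideanSpace ℝ (Fin 4) →ₗ[ℝ] EuclideanSpace ℝ (Fin 4)) = 2 * u 0 := by
  set T : EuclideanSpace ℝ (Fin 4) →L[ℝ] EuclideanSpace ℝ (Fin 4) :=
    ContinuousLinearMap.id ℝ (EuclideanSpace ℝ (Fin 4)) +
      ((2 * u 0 - 1) • (EuclideanSpace.proj (0 : Fin 4) : EuclideanSpace ℝ (Fin 4) →L[ℝ] ℝ)).smulRight
        (EuclideanSpace.single (0 : Fin 4) (1 : ℝ)) with hT
  set b := EuclideanSpace.basisFun (Fin 4) ℝ with hb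
  -- the scaling factors on the standard basis
  set c : Fin 4 → ℝ := fun j => if j = 0 then 2 * u 0 else 1 with hc
  have hTb : ((T : EuclideanSpace ℝ (Fin 4) →ₗ[ℝ] EuclideanSpace ℝ (Fin 4)) : EuclideanSpace ℝ (Fin 4) →
      EuclideanSpace ℝ (Fin 4)) ∘ (⇑b.toBasis) = fun j => c j • b.toBasis j := by
    funext j
    simp only [Function.comp_apply, ContinuousLinearMap.coe_coe, hT, foldModelDeriv_apply, hc]
    fin_cases j
    · ext i
      fin_cases i <;> simp [hb]
    · ext i
      fin_cases i <;> simp [hb]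
    · ext i
      fin_cases i <;> simp [hb]
    · ext i
      fin_cases i <;> simp [hb]
  have h1 := Module.Basis.det_comp b.toBasis (T : EuclideanSpace ℝ (Fin 4) →ₗ[ℝ]
    EuclideanSpace ℝ (Fin 4)) b.toBasis
  rw [Module.Basis.det_self, mul_one, hTb] at h1
  have h2 : b.toBasis.det (fun j => c j • b.toBasis j) = (∏ j, c j) • b.toBasis.det b.toBasis :=
    b.toBasis.det.toMultilinearMap.map_smul_univ c b.toBasis
  rw [Module.Basis.det_self, smul_eq_mul, mul_one, Fin.prod_univ_four] at h2
  rw [← h1, h2]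
  simp [hc]

end Summit.SmoothPoincare4.SmoothPoincare4.Theorems.FoldedSphereFoldExistence

end
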